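import Summits.QuantumFields.YangMills.Theorems.LuscherReductionTwistedTraceScalingWindowDefs
import Summits.QuantumFields.YangMills.Theorems.LuscherReductionRunningReductionCoarseUpperCopies
import HarnessLib

/-!
# THE `k`-UNIFORM INNER WINDOW: the eight-copies step `InnerWindowOneOrbitAt L δ → InnerWindowAt L δ` (brick W5 of the lattice window floor W(L); lane A of S-BASE,
# crux `TwistedTraceScaling` stmt-QuantumFields-20203, line «twolattice», stub `stub_fixedLatticeTraceLaw`; card `pub/ym-fleet/ym-luscher-20007-p1/Lines-window-floor.md`; lead g24)

The `k`-uniform twin of ✓`innerNoIntruderAt_of_oneOrbit` (`…CoarseUpperCopies`): a physical family supported in the union of the eight inner neighbourhoods `{orbitDist(τ_z U) < δ}` is the twist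
symmetrisation of its one-orbit cut (✓`twistSum_orbitCut`, `L·δ < 2`), `‖Σ aᵢFᵢ‖² = 8‖Σ aᵢGᵢ‖²` (✓`l2_twistSum`), `⟨Σ aᵢFᵢ, K Σ aᵢFᵢ⟩ ≤ 8⟨Σ aᵢGᵢ, K Σ aᵢGᵢ⟩ + 56·crossBound·‖Σ aᵢGᵢ‖²`
(✓`abs_qform_twistSum_sub_le`), and the cross terms are `≤ (ε/2)λ_b·λ₀/28` eventually (✓`crossBound_eventually_small`, `k`-free).  No input from crux ONE (the per-level proof used `μ_k ≥ μ₀/2`;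
the window coefficient `max μ_k (θμ₀) + ελ_bμ₀` absorbs the cross terms additively instead).
* `copies_window_endgame` — the real arithmetic;
* ★★ `innerWindowAt_of_oneOrbit : (∀ β, 0 < δ β) → (eventually δ β ≤ 1/(2L)) → InnerWindowOneOrbitAt L δ → InnerWindowAt L δ`;
* ★★ `innerWindowAt_pow_of_oneOrbit` — polynomial radii `δ = β^{−s}`, `s > 0`.
HONEST FRAMING: bookkeeping for a stub of a child of the CONDITIONAL reduction route R2b1; W(L), S-BASE and the crux stay OPEN; fixed lattice size; not infinite volume, not a mass gap, not Clay.
No definitions, no `sorry`.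
-/

set_option autoImplicit false

noncomputable section

open MeasureTheory Filter Topology Real
open scoped BigOperators
open Literature.MathematicalPhysics.QuantumFieldTheory
open Literature.MathematicalPhysics.QuantumLattice

namespace Summit.QuantumFields.YangMills.Theorems.FemtoTransferGap

variable {L : ℕ} [NeZero L]

/-! ## §1 The arithmetic -/

/-- Pure-real endgame of the eight-copies step in window currency: `q_F ≤ 8q_G + 56cB·n_G`, `q_G·μ₀ ≤ (M + (ε/2)λμ₀)·Λ₀·n_G`, `28cB ≤ (ε/2)λΛ₀` give
`q_F·μ₀ ≤ (M + ελμ₀)·Λ₀·(8n_G)`. [folklore] -/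
theorem copies_window_endgame {qF qG nG μ0 M Λ0 cB lam ε : ℝ} (hnG : 0 ≤ nG) (hμ0 : 0 ≤ μ0) (hΛ0 : 0 ≤ Λ0) (hlam : 0 ≤ lam) (hε : 0 ≤ ε)
    (hq : qF ≤ 8 * qG + 56 * (cB * nG)) (hI : qG * μ0 ≤ (M + ε / 2 * lam * μ0) * Λ0 * nG) (hsc : 28 * cB ≤ ε / 2 * lam * Λ0) :
    qF * μ0 ≤ (M + ε * lam * μ0) * Λ0 * (8 * nG) := by
  have h3 : qF * μ0 ≤ 8 * (qG * μ0) + 56 * (cB * nG) * μ0 := by nlinarith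
  have h4 : 56 * (cB * nG) * μ0 ≤ ε * lam * Λ0 * μ0 * nG := by
    have h56 : 56 * cB ≤ ε * lam * Λ0 := by linarith
    have := mul_le_mul_of_nonneg_right h56 (mul_nonneg hnG hμ0)
    nlinarith
  have h5 : 0 ≤ lam * μ0 * Λ0 * nG := by positivity
  nlinarith

/-! ## §2 ★★ The eight-copies step -/

set_option maxHeartbeats 400000 in
/-- ★★ **THE `k`-UNIFORM INNER WINDOW from its one-orbit form**: `InnerWindowOneOrbitAt L δ → InnerWindowAt L δ` for positive scales that are eventually `≤ 1/(2L)` (same `θ`).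
[cite: Luscher1983, §3] -/
theorem innerWindowAt_of_oneOrbit {δ : ℝ → ℝ} (hδ : ∀ β, 0 < δ β) (hδL : ∃ β1 : ℝ, ∀ β : ℝ, β1 ≤ β → δ β ≤ 1 / (2 * L))
    (hI1 : InnerWindowOneOrbitAt L δ) : InnerWindowAt L δ := by
  obtain ⟨θ, hθ, hI⟩ := hI1
  refine ⟨θ, hθ, fun ε hε => ?_⟩
  have hL : (0 : ℝ) < L := by exact_mod_cast Nat.pos_of_ne_zero (NeZero.ne L)
  have hL1 : (1 : ℝ) ≤ (L : ℝ) ^ 3 := one_le_pow₀ (by exact_mod_cast NeZero.one_le)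
  obtain ⟨βI, hI1'⟩ := hI (ε / 2) (half_pos hε)
  obtain ⟨β1, hδ1⟩ := hδL
  obtain ⟨βs, hs⟩ := crossBound_eventually_small (L := L) (m := 1 / (2 * L)) (by positivity) (half_pos hε)
  refine ⟨max (max 1 (max βI β1)) βs, fun β hβ k F hF hsupp hGram => ?_⟩
  have hβ1 : 1 ≤ β := ((le_max_left _ _).trans (le_max_left _ _)).trans hβ
  have hβ0 : 0 < β := by linarith
  have hβI : βI ≤ β := (((le_max_left _ _).trans (le_max_right _ _)).trans (le_max_left _ _)).trans hβ
  have hβd : β1 ≤ β := (((le_max_right _ _).trans (le_max_right _ _)).trans (le_max_left _ _)).trans hβ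
  have hβs : βs ≤ β := (le_max_right _ _).trans hβ
  -- geometry of the scales
  have hδ0 := hδ β
  have hδ2 : δ β ≤ 1 / (2 * L) := hδ1 β hβd
  have hLδ : (L : ℝ) * δ β < 2 := by
    have := mul_le_mul_of_nonneg_left hδ2 hL.le
    have e : (L : ℝ) * (1 / (2 * L)) = 1 / 2 := by field_simp
    linarith
  have hLm : (L : ℝ) * (δ β + 1 / (2 * L)) < 2 := by
    have := mul_le_mul_of_nonneg_left hδ2 hL.le
    have e : (L : ℝ) * (1 / (2 * L)) = 1 / 2 := by field_simp
    nlinarith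
  -- one-site data
  have hB'β : β ≤ (L : ℝ) ^ 3 * β := by nlinarith
  have hB'0 : 0 < (L : ℝ) ^ 3 * β := lt_of_lt_of_le hβ0 hB'β
  have hμ0 : 0 < levelValue su2Rep 1 ((L : ℝ) ^ 3 * β) 0 := levelValue_su2Rep_pos (L := 1) hB'0 0
  have hlam0 : 0 < bareLambda ((L : ℝ) ^ 3 * β) := bareLambda_pos' hB'0
  have hΛ0 : 0 < levelValue su2Rep L β 0 := levelValue_su2Rep_pos hβ0 0
  have hsc : 28 * crossBound L β (1 / (2 * L)) ≤ ε / 2 * bareLambda ((L : ℝ) ^ 3 * β) * levelValue su2Rep L β 0 :=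
    (hs β hβs).trans (mul_le_mul_of_nonneg_left (levelValue_zero_ge_uniform hβ1) (by positivity))
  -- the one-orbit cut family
  choose C hC using fun i => (hF i).bounded
  obtain ⟨G, hGdef⟩ : ∃ G : Fin (k + 1) → GaugeConfig 3 L SU2 → ℝ, G = fun i => orbitCut (δ β) (F i) := ⟨_, rfl⟩
  have hGm : ∀ i, Measurable (G i) := fun i => by rw [hGdef]; exact measurable_orbitCut _ (hF i).measurable
  have hGb : ∀ i, ∃ C' : ℝ, ∀ U, |G i U| ≤ C' := fun i => ⟨C i, fun U => by rw [hGdef]; exact abs_orbitCut_le _ (hC i) U⟩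
  have hGg : ∀ i (g : Site 3 L → SU2) (U : GaugeConfig 3 L SU2), G i (gaugeTransform g U) = G i U := fun i g U => by
    rw [hGdef]; exact orbitCut_gaugeTransform _ (hF i).gaugeInv g U
  have hGs : ∀ i U, G i U ≠ 0 → orbitDist U < δ β := fun i U h => by
    rw [hGdef] at h; exact orbitDist_lt_of_orbitCut_ne_zero h
  -- combinations: `Σ aᵢFᵢ = twistSum (Σ aᵢGᵢ)`
  have hcomb : ∀ a : Fin (k + 1) → ℝ, (fun U => ∑ i, a i * F i U) = twistSum (fun U => ∑ i, a i * G i U) := fun a => by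
    rw [twistSum_sum_mul]
    funext U
    refine Finset.sum_congr rfl fun i _ => ?_
    rw [hGdef, twistSum_orbitCut hLδ (hF i) (hsupp i)]
  have hφm : ∀ a : Fin (k + 1) → ℝ, Measurable fun U => ∑ i, a i * G i U := fun a => by
    rw [hGdef]; exact measurable_sum_mul_orbitCut _ a fun i => (hF i).measurable
  have hφb : ∀ (a : Fin (k + 1) → ℝ) U, |∑ i, a i * G i U| ≤ ∑ i, |a i| * C i := fun a U => by
    rw [hGdef]; exact abs_sum_mul_orbitCut_le _ a hC U
  have hφs : ∀ (a : Fin (k + 1) → ℝ) U, ∑ i, a i * G i U ≠ 0 → orbitDist U < δ β := fun a U h => by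
    rw [hGdef] at h; exact orbitDist_lt_of_sum_mul_orbitCut_ne_zero a F h
  have hl2 : ∀ a : Fin (k + 1) → ℝ, l2 (fun U => ∑ i, a i * F i U) (fun U => ∑ i, a i * F i U) =
      8 * l2 (fun U => ∑ i, a i * G i U) (fun U => ∑ i, a i * G i U) := fun a => by
    rw [hcomb a]; exact l2_twistSum (hφm a) (hφb a) hLδ (hφs a)
  have hq : ∀ a : Fin (k + 1) → ℝ, qform su2Rep β (fun U => ∑ i, a i * F i U) (fun U => ∑ i, a i * F i U) ≤
      8 * qform su2Rep β (fun U => ∑ i, a i * G i U) (fun U => ∑ i, a i * G i U) +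
        56 * (crossBound L β (1 / (2 * L)) * l2 (fun U => ∑ i, a i * G i U) (fun U => ∑ i, a i * G i U)) := fun a => by
    rw [hcomb a]
    have h := abs_qform_twistSum_sub_le hβ0.le (hφm a) (hφb a) (by positivity : (0 : ℝ) ≤ 1 / (2 * L)) hLm (hφs a)
    rw [abs_le] at h
    linarith [h.2]
  -- Gram nondegeneracy transfers
  have hGramG : ∀ a : Fin (k + 1) → ℝ, a ≠ 0 → 0 < l2 (fun U => ∑ i, a i * G i U) (fun U => ∑ i, a i * G i U) := fun a ha => by
    have h := hGram a ha
    rw [hl2 a] at h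
    linarith
  -- apply the one-orbit window and conclude
  obtain ⟨a, ha, hIa⟩ := hI1' β hβI k G hGm hGb hGg hGs hGramG
  refine ⟨a, ha, ?_⟩
  rw [hl2 a]
  exact copies_window_endgame (l2_self_nonneg_lat _) hμ0.le hΛ0.le hlam0.le hε.le (hq a) hIa hsc

/-- ★★ **Polynomial radii**: `InnerWindowOneOrbitAt L (β^{−s}) → InnerWindowAt L (β^{−s})` for `s > 0`. [cite: Luscher1983, §3] -/
theorem innerWindowAt_pow_of_oneOrbit {s : ℝ} (hs : 0 < s) (hI1 : InnerWindowOneOrbitAt L (powScale s)) : InnerWindowAt L (powScale s) := by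
  have hL : (0 : ℝ) < L := by exact_mod_cast Nat.pos_of_ne_zero (NeZero.ne L)
  exact innerWindowAt_of_oneOrbit (fun β => powScale_pos s β) (powScale_eventually_le hs (by positivity)) hI1

end Summit.QuantumFields.YangMills.Theorems.FemtoTransferGap

end
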